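import Summits.CriticalPhenomena.PercolationContinuityZ3.Theorems.PercNearOneGluingNoHeavyQuantResplitStrictDisplays
import HarnessLib

/-!
# QUANT lane / PAPER-2 rate track (ARM-2, gen 12): lever (L1f) STRICT WINDOW, the `d = 7, 8, 9, 10` rows for every `p ≤ p_c`
# (`2⁻⁶⁸⁹⁷⁰`, `2⁻¹⁵⁹⁰³⁷`, `2⁻³⁶⁰⁶³⁴`, `2⁻⁸⁰⁷⁰⁴⁰`; `rsTauU` rows: 69866 / 161085 / 365242 / 817280)

builds on p205010 (kernel theorem, internal audit signed; external expert review pending)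

Cell `prim-quant`, seat `prim-quant-arm-2` (constants bookkeeper; `RATE-CONSTANTS.md` §2l).  Companion of `…QuantResplitStrictDisplays` (d = 3..6,
uniform): the strict-window defect `(rsDeltaE 2⁻³ d ^ 2)^(d·2^d) = 1/(6 021 120 000·(d+1)²)^{2·d·2^d}` sandwiched by exact integer comparison for
`d = 7..10` (`one_div_sandwich_of_nat`, `decide +kernel`), and the displays `π_p(N) ≤ (1 − 2^{−k_d})^⌊(log*₂ N − 6)/2⌋` for every `p ≤ p_c(ℤ^d)`,
`k_7 = 68970`, `k_8 = 159037`, `k_9 = 360634`, `k_10 = 807040` (gain `d·2^d` = 896 / 2048 / 4608 / 10240 bits over the `rsTauU` rows of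
`…QuantResplitDisplaysMidD`).  Exact integers: `quant/prim-quant-arm-2-g12/code/strict_numerals.py`.
HONEST SENTENCE (unchanged): explicit functions tending to `0` of iterated-logarithm type and nothing more; class log*; these mid-`d` rows are
calibration lines (`d ≥ 11`: mean-field via the lace expansion).  No definitions, no sorries.
[cite: KozmaNitzan2024, §4 Theorem 6 (pp. 25–31)] [cite: DuminilcopinKozmaTassion2020, Proposition 1]
-/

noncomputable section

namespace Summit.CriticalPhenomena.PercolationContinuityZ3.Theorems.Quant

open MeasureTheory Literature.Probability.Percolation Literature.Probability.LatticeModels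
open Literature.Probability.Percolation.KozmaNitzan Literature.Probability.Percolation.AKN
open scoped Classical

namespace Resplit

/-! ## Sandwiches `d = 7, 8, 9, 10` -/

/-- `d = 7` at `2⁻³`, strict window: `(1/2)^68970 < (rsDeltaE 2⁻³ 7 ^ 2)^(7·2^7) < (1/2)^68969` (`rsTauU` row: `69866/69865`). [folklore] (numeric) -/
theorem rsStrictOrbit_three_seven_sharp :
    (1 / 2 : ℝ) ^ 68970 < (rsDeltaE ((1 / 2 : ℝ) ^ 3) 7 ^ 2) ^ (7 * 2 ^ 7) ∧
      (rsDeltaE ((1 / 2 : ℝ) ^ 3) 7 ^ 2) ^ (7 * 2 ^ 7) < (1 / 2 : ℝ) ^ 68969 := by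
  rw [rsStrict_eighth_pow_castForm (by norm_num)]
  exact one_div_sandwich_of_nat (A := 1) (C := 6021120000 * (7 + 1) ^ 2) (Klo := 1) (Khi := 1) (K := 1)
    (n := 2 * (7 * 2 ^ 7)) (a := 68969) (by positivity) (by positivity) (by norm_num) le_rfl le_rfl
    (by decide +kernel) (by decide +kernel)

/-- `d = 8` at `2⁻³`, strict window: `(1/2)^159037 < (rsDeltaE 2⁻³ 8 ^ 2)^(8·2^8) < (1/2)^159036` (`rsTauU` row: `161085/161084`). [folklore] (numeric) -/
theorem rsStrictOrbit_three_eight_sharp :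
    (1 / 2 : ℝ) ^ 159037 < (rsDeltaE ((1 / 2 : ℝ) ^ 3) 8 ^ 2) ^ (8 * 2 ^ 8) ∧
      (rsDeltaE ((1 / 2 : ℝ) ^ 3) 8 ^ 2) ^ (8 * 2 ^ 8) < (1 / 2 : ℝ) ^ 159036 := by
  rw [rsStrict_eighth_pow_castForm (by norm_num)]
  exact one_div_sandwich_of_nat (A := 1) (C := 6021120000 * (8 + 1) ^ 2) (Klo := 1) (Khi := 1) (K := 1)
    (n := 2 * (8 * 2 ^ 8)) (a := 159036) (by positivity) (by positivity) (by norm_num) le_rfl le_rfl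
    (by decide +kernel) (by decide +kernel)

/-- `d = 9` at `2⁻³`, strict window: `(1/2)^360634 < (rsDeltaE 2⁻³ 9 ^ 2)^(9·2^9) < (1/2)^360633` (`rsTauU` row: `365242/365241`). [folklore] (numeric) -/
theorem rsStrictOrbit_three_nine_sharp :
    (1 / 2 : ℝ) ^ 360634 < (rsDeltaE ((1 / 2 : ℝ) ^ 3) 9 ^ 2) ^ (9 * 2 ^ 9) ∧
      (rsDeltaE ((1 / 2 : ℝ) ^ 3) 9 ^ 2) ^ (9 * 2 ^ 9) < (1 / 2 : ℝ) ^ 360633 := by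
  rw [rsStrict_eighth_pow_castForm (by norm_num)]
  exact one_div_sandwich_of_nat (A := 1) (C := 6021120000 * (9 + 1) ^ 2) (Klo := 1) (Khi := 1) (K := 1)
    (n := 2 * (9 * 2 ^ 9)) (a := 360633) (by positivity) (by positivity) (by norm_num) le_rfl le_rfl
    (by decide +kernel) (by decide +kernel)

/-- `d = 10` at `2⁻³`, strict window: `(1/2)^807040 < (rsDeltaE 2⁻³ 10 ^ 2)^(10·2^10) < (1/2)^807039` (`rsTauU` row: `817280/817279`). [folklore] (numeric) -/
theorem rsStrictOrbit_three_ten_sharp :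
    (1 / 2 : ℝ) ^ 807040 < (rsDeltaE ((1 / 2 : ℝ) ^ 3) 10 ^ 2) ^ (10 * 2 ^ 10) ∧
      (rsDeltaE ((1 / 2 : ℝ) ^ 3) 10 ^ 2) ^ (10 * 2 ^ 10) < (1 / 2 : ℝ) ^ 807039 := by
  rw [rsStrict_eighth_pow_castForm (by norm_num)]
  exact one_div_sandwich_of_nat (A := 1) (C := 6021120000 * (10 + 1) ^ 2) (Klo := 1) (Khi := 1) (K := 1)
    (n := 2 * (10 * 2 ^ 10)) (a := 807039) (by positivity) (by positivity) (by norm_num) le_rfl le_rfl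
    (by decide +kernel) (by decide +kernel)

/-! ## Displays `d = 7, 8, 9, 10`, every `p ≤ p_c` -/

/-- **`ℤ⁷`, strict window, every `p ≤ p_c(ℤ⁷)`**: `π_p(N) ≤ (1 − 2^{−68970})^⌊(log*₂ N − 6)/2⌋` (`rsTauU` row: `1 − 2^{−69866}`).
An explicit function tending to `0` and nothing more.
builds on p205010 (kernel theorem, internal audit signed; external expert review pending). [cite: KozmaNitzan2024, §4 Theorem 6] -/
theorem oneArm_rate_Z7_three_strict_of_le (p : unitInterval) (hpc : p ≤ criticalProbI 7) (N : ℕ) :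
    oneArmProb 7 p N ≤ (1 - (1 / 2 : ℝ) ^ 68970) ^ ((logStar 2 N - 6) / 2) :=
  oneArm_le_of_window (d := 7) (by norm_num) (B := fun N => (1 - (1 / 2 : ℝ) ^ 68970) ^ ((logStar 2 N - 6) / 2))
    (fun q hq hqc N => PkSharp.oneArm_le_base_pow_of_scaleDefect (by norm_num)
      (rsStrictThreeScaleDefect_of_le_criticalProbI_orbit (d := 7) (by norm_num) q hq hqc) (fun m => le_rsLHi _ 7 m)
      (fun m => rsLHi_le_knLHi (d := 7) (by norm_num) knEps_le_half_pow_three_div_two (by positivity) (by norm_num) m) (by positivity)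
      rsStrictOrbit_three_seven_sharp.1.le (rsStrict_pow_orbit_le_one 7 (by positivity) (by norm_num))
      (knShiftC_eq_six_of_le32 (d := 7) (by norm_num) (by norm_num)).le N)
    p hpc N

/-- **`ℤ⁸`, strict window, every `p ≤ p_c(ℤ⁸)`**: `π_p(N) ≤ (1 − 2^{−159037})^⌊(log*₂ N − 6)/2⌋` (`rsTauU` row: `1 − 2^{−161085}`).
An explicit function tending to `0` and nothing more.
builds on p205010 (kernel theorem, internal audit signed; external expert review pending). [cite: KozmaNitzan2024, §4 Theorem 6] -/
theorem oneArm_rate_Z8_three_strict_of_le (p : unitInterval) (hpc : p ≤ criticalProbI 8) (N : ℕ) :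
    oneArmProb 8 p N ≤ (1 - (1 / 2 : ℝ) ^ 159037) ^ ((logStar 2 N - 6) / 2) :=
  oneArm_le_of_window (d := 8) (by norm_num) (B := fun N => (1 - (1 / 2 : ℝ) ^ 159037) ^ ((logStar 2 N - 6) / 2))
    (fun q hq hqc N => PkSharp.oneArm_le_base_pow_of_scaleDefect (by norm_num)
      (rsStrictThreeScaleDefect_of_le_criticalProbI_orbit (d := 8) (by norm_num) q hq hqc) (fun m => le_rsLHi _ 8 m)
      (fun m => rsLHi_le_knLHi (d := 8) (by norm_num) knEps_le_half_pow_three_div_two (by positivity) (by norm_num) m) (by positivity)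
      rsStrictOrbit_three_eight_sharp.1.le (rsStrict_pow_orbit_le_one 8 (by positivity) (by norm_num))
      (knShiftC_eq_six_of_le32 (d := 8) (by norm_num) (by norm_num)).le N)
    p hpc N

/-- **`ℤ⁹`, strict window, every `p ≤ p_c(ℤ⁹)`**: `π_p(N) ≤ (1 − 2^{−360634})^⌊(log*₂ N − 6)/2⌋` (`rsTauU` row: `1 − 2^{−365242}`).
An explicit function tending to `0` and nothing more.
builds on p205010 (kernel theorem, internal audit signed; external expert review pending). [cite: KozmaNitzan2024, §4 Theorem 6] -/
theorem oneArm_rate_Z9_three_strict_of_le (p : unitInterval) (hpc : p ≤ criticalProbI 9) (N : ℕ) :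
    oneArmProb 9 p N ≤ (1 - (1 / 2 : ℝ) ^ 360634) ^ ((logStar 2 N - 6) / 2) :=
  oneArm_le_of_window (d := 9) (by norm_num) (B := fun N => (1 - (1 / 2 : ℝ) ^ 360634) ^ ((logStar 2 N - 6) / 2))
    (fun q hq hqc N => PkSharp.oneArm_le_base_pow_of_scaleDefect (by norm_num)
      (rsStrictThreeScaleDefect_of_le_criticalProbI_orbit (d := 9) (by norm_num) q hq hqc) (fun m => le_rsLHi _ 9 m)
      (fun m => rsLHi_le_knLHi (d := 9) (by norm_num) knEps_le_half_pow_three_div_two (by positivity) (by norm_num) m) (by positivity)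
      rsStrictOrbit_three_nine_sharp.1.le (rsStrict_pow_orbit_le_one 9 (by positivity) (by norm_num))
      (knShiftC_eq_six_of_le32 (d := 9) (by norm_num) (by norm_num)).le N)
    p hpc N

/-- **`ℤ¹⁰`, strict window, every `p ≤ p_c(ℤ¹⁰)`**: `π_p(N) ≤ (1 − 2^{−807040})^⌊(log*₂ N − 6)/2⌋` (`rsTauU` row: `1 − 2^{−817280}`).
An explicit function tending to `0` and nothing more.
builds on p205010 (kernel theorem, internal audit signed; external expert review pending). [cite: KozmaNitzan2024, §4 Theorem 6] -/
theorem oneArm_rate_Z10_three_strict_of_le (p : unitInterval) (hpc : p ≤ criticalProbI 10) (N : ℕ) :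
    oneArmProb 10 p N ≤ (1 - (1 / 2 : ℝ) ^ 807040) ^ ((logStar 2 N - 6) / 2) :=
  oneArm_le_of_window (d := 10) (by norm_num) (B := fun N => (1 - (1 / 2 : ℝ) ^ 807040) ^ ((logStar 2 N - 6) / 2))
    (fun q hq hqc N => PkSharp.oneArm_le_base_pow_of_scaleDefect (by norm_num)
      (rsStrictThreeScaleDefect_of_le_criticalProbI_orbit (d := 10) (by norm_num) q hq hqc) (fun m => le_rsLHi _ 10 m)
      (fun m => rsLHi_le_knLHi (d := 10) (by norm_num) knEps_le_half_pow_three_div_two (by positivity) (by norm_num) m) (by positivity)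
      rsStrictOrbit_three_ten_sharp.1.le (rsStrict_pow_orbit_le_one 10 (by positivity) (by norm_num))
      (knShiftC_eq_six_of_le32 (d := 10) (by norm_num) (by norm_num)).le N)
    p hpc N

end Resplit

end Summit.CriticalPhenomena.PercolationContinuityZ3.Theorems.Quant

end
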